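import Summits.CriticalPhenomena.PercolationContinuityZ3.Theorems.PercNearOneGluingNoHeavyPcintLoopExclusionSiteLaw
import Summits.CriticalPhenomena.PercolationContinuityZ3.Theorems.PercNearOneGluingNoHeavyPcintLoopExclusionFirstRungs
import Summits.CriticalPhenomena.PercolationContinuityZ3.Theorems.PercNearOneGluingNoHeavyPcintNawMemoryFour
import HarnessLib

/-!
# CriticalPhenomena/PercolationContinuityZ3 — Theorems/PercNearOneGluingNoHeavyPcintLoopExclusionSiteFirstRung.lean: the first rung of the SITE memory hierarchy — `μ^N_2 = 2d − 1`, `μ^N_4 ≤ (d−1) + √((d−1)²+1) < 2d − 1` — and the PROVED instance `R^N_4(d) > 0` of the typed site law C4-site (a)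

Lane prim-pcint, STRUCTURE rule; companion of …PcintLoopExclusionSiteLaw (site twin of C4, typed) and the site analogue of
…PcintLoopExclusionFirstRungs.  Clause (a) of the site law asserts `0 < R^N_{2m}(d) < 1`; its lower half is the strict
monotonicity `μ^N_{2m} < μ^N_{2m−2}` of the neighbour-avoiding memory hierarchy.  The first instance, in every dimension `d ≥ 2`:

* `nawMemWords_two_eq_memWords_two` (neighbour-avoidance memory `2` = plain memory `2` = non-backtracking: the extra
  non-adjacency constraint at gap `2` is void by parity), whence **`nawMemGrowth_two_eq` : `μ^N_2(d) = 2d − 1`**;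
* `isNAWFour_of_isNawMem` (memory `3 ≤ 4` ⇒ the tree's `IsNAWFour`: no reversal, no `(a, b, −a)`), so the tree's two-class
  count bound `card_nawFourWords_le_geometric` (…PcintNawMemoryFour) applies to `nawMemCount d 4`:
  **`nawMemGrowth_four_le_nawFourConst` : `μ^N_4(d) ≤ λ_d = (d−1) + √((d−1)²+1)`** (the engines find `μ^N_4(ℤ³) = 2 + √5` exactly)
  and **`nawMemGrowth_four_lt` : `μ^N_4(d) < 2d − 1 = μ^N_2(d)`**;
* **`siteLoopCost_four_pos` : `Δ^N_4(d) > 0`** and **`siteLoopCompat_four_pos` : `R^N_4(d) > 0`** for every `d ≥ 2` (measured: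
  `R^N_4 = 0.720 / 0.797 / 0.869` for `d = 3, 4, 6`); the upper inequality and higher rungs remain conjectural.

HONEST FRAMING: elementary, built from the tree's memory-4 NAW counting; new only as statements about the typed objects.  Nothing
here is used by a certified `p_c` cell.  Written by prim-pcint-2 gen 16 (prover-prim-pcint-2-g16-0), 2026-08-24.
-/

noncomputable section

open Filter Topology
open Literature.Probability.LatticeModels Literature.Probability.Percolation
open Summit.CriticalPhenomena.PercolationContinuityZ3.Theorems.Pcint

namespace Summit.CriticalPhenomena.PercolationContinuityZ3.Theorems.Pcint.NawTail

variable {d : ℕ}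

/-! ### Memory 2: `μ^N_2 = μ_2 = 2d − 1` -/

/-- Neighbour-avoidance memory `2` is plain memory `2` (no adjacency constraint bites at gap `2`, by parity). [folklore] -/
theorem isNawMem_two_iff {n : ℕ} (w : Fin n → Fin d × Bool) : IsNawMem 2 w ↔ IsMem 2 w := by
  refine ⟨fun h i j hj hij hτ => (h i j hj hij hτ).1, fun h i j hj hij hτ => ⟨h i j hj hij hτ, fun h2 => ?_⟩⟩
  exact not_adj_wordPos_of_even w (by omega) hj (by omega)

/-- `nawMemWords d 2 n = memWords d 2 n`. [folklore] -/
theorem nawMemWords_two_eq_memWords_two (d n : ℕ) : nawMemWords d 2 n = MemoryTail.memWords d 2 n := by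
  classical
  ext w
  rw [mem_nawMemWords, MemoryTail.mem_memWords]
  exact isNawMem_two_iff w

/-- **`μ^N_2(d) = μ_2(d) = 2d − 1`** (`d ≥ 1`). [cite: MadrasSlade1993, §1.2 (1.2.13)] -/
theorem nawMemGrowth_two_eq [NeZero d] : nawMemGrowth d 2 = 2 * (d : ℝ) - 1 := by
  rw [← MemoryTail.memGrowth_two_eq (d := d)]
  unfold nawMemGrowth MemoryTail.memGrowth nawMemCount MemoryTail.memCount
  simp_rw [nawMemWords_two_eq_memWords_two]

/-! ### Memory 4: the two-class bound `μ^N_4 ≤ λ_d < 2d − 1` -/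

/-- Neighbour-avoidance memory `3` implies the tree's `IsNAWFour` (no reversal — a coincidence at gap `2`; no `(a, b, −a)` — an
adjacency at gap `3`, `wordPos_add_three_of_srev`). [folklore] -/
theorem isNAWFour_of_isNawMem {n : ℕ} {w : Fin n → Fin d × Bool} (h : IsNawMem 3 w) : IsNAWFour w := by
  refine ⟨fun k hk hrev => (h k (k + 2) (by omega) (by omega) (by omega)).1 (wordPos_add_two_of_srev w hk hrev).symm,
    fun k hk hrev => (h k (k + 3) (by omega) (by omega) (by omega)).2 (by omega) ?_⟩
  rw [wordPos_add_three_of_srev w hk hrev]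
  exact (zdGraph_adj_iff_stepVec _ _).2 ⟨_, rfl⟩

/-- `nawMemWords d 4 n ⊆ nawFourWords d n`. [folklore] -/
theorem nawMemWords_four_subset (d n : ℕ) : nawMemWords d 4 n ⊆ nawFourWords d n := fun w hw =>
  mem_nawFourWords.2 (isNAWFour_of_isNawMem ((mem_nawMemWords.1 hw).anti (by omega)))

/-- `K^{1/(n+2)} → 1` as `n → ∞` for `K > 0` (continuity of `x ↦ K^x` at `0`). [folklore] -/
private theorem tendsto_const_rpow_inv_add_two {K : ℝ} (hK : 0 < K) :
    Tendsto (fun n : ℕ => K ^ (1 / ((n : ℝ) + 2))) atTop (𝓝 1) := by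
  have h0 : ContinuousAt (fun x : ℝ => K ^ x) 0 := Real.continuousAt_const_rpow hK.ne'
  have h1 : Tendsto (fun n : ℕ => 1 / ((n : ℝ) + 2)) atTop (𝓝 0) := by
    have := tendsto_one_div_add_atTop_nhds_zero_nat (𝕜 := ℝ)
    have h2 := this.comp (tendsto_add_atTop_nat 1)
    refine h2.congr fun n => ?_
    simp only [Function.comp_apply]; push_cast; ring
  simpa [Real.rpow_zero, Function.comp_def] using h0.tendsto.comp h1

/-- A geometric count bound bounds the memory growth constant: `N_{n+2,τ} ≤ K λ^{n+1}` for all `n` ⇒ `μ^N_τ ≤ λ` (the argument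
of `nawConst_le_of_card_le_geometric`, for `nawMemGrowth`). [folklore] -/
theorem nawMemGrowth_le_of_card_le_geometric {τ : ℕ} {K lam : ℝ} (hK : 0 < K) (hlam : 0 < lam)
    (h : ∀ n : ℕ, (nawMemCount d τ (n + 2) : ℝ) ≤ K * lam ^ (n + 1)) : nawMemGrowth d τ ≤ lam := by
  have hg : Tendsto (fun n : ℕ => (K / lam) ^ (1 / ((n : ℝ) + 2)) * lam) atTop (𝓝 lam) := by
    have := (tendsto_const_rpow_inv_add_two (div_pos hK hlam)).mul_const lam
    rwa [one_mul] at this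
  refine ge_of_tendsto hg (Eventually.of_forall fun n => ?_)
  have hn2 : (0 : ℝ) < (n : ℝ) + 2 := by positivity
  have h1 : nawMemGrowth d τ ≤ (nawMemCount d τ (n + 2) : ℝ) ^ (1 / ((n : ℝ) + 2)) := by
    have := nawMemGrowth_le_rpow d τ (n := n + 2) (by omega)
    simpa [Nat.cast_add] using this
  refine h1.trans ?_
  have h2 : (nawMemCount d τ (n + 2) : ℝ) ^ (1 / ((n : ℝ) + 2)) ≤ (K * lam ^ (n + 1)) ^ (1 / ((n : ℝ) + 2)) :=
    Real.rpow_le_rpow (Nat.cast_nonneg _) (h n) (by positivity)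
  refine h2.trans (le_of_eq ?_)
  have hKl : K * lam ^ (n + 1) = (K / lam) * lam ^ (n + 2) := by
    field_simp
    ring
  rw [hKl, Real.mul_rpow (div_pos hK hlam).le (by positivity)]
  congr 1
  rw [← Real.rpow_natCast lam (n + 2), ← Real.rpow_mul hlam.le]
  push_cast
  rw [mul_one_div_cancel hn2.ne', Real.rpow_one]

/-- **`μ^N_4(d) ≤ λ_d = (d−1) + √((d−1)²+1)`** for `d ≥ 2` (the two-class recursion of …PcintNawMemoryFour; `d = 3`: `2 + √5`,
the engines' exact value of `μ^site_4(ℤ³)`). [folklore] -/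
theorem nawMemGrowth_four_le_nawFourConst (hd : 2 ≤ d) :
    nawMemGrowth d 4 ≤ (d - 1 : ℝ) + Real.sqrt ((d - 1) ^ 2 + 1) := by
  classical
  have hd' : (2 : ℝ) ≤ d := by exact_mod_cast hd
  set r := Real.sqrt (((d : ℝ) - 1) ^ 2 + 1) with hr
  have hr0 : 0 ≤ r := Real.sqrt_nonneg _
  have hr2 : r ^ 2 = ((d : ℝ) - 1) ^ 2 + 1 := Real.sq_sqrt (by positivity)
  have hr1 : 1 ≤ r := by nlinarith [sq_nonneg (r + 1)]
  have hlam2 : (2 : ℝ) ≤ (d - 1 : ℝ) + r := by linarith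
  have hroot : (2 * d - 2 : ℝ) * ((d - 1 : ℝ) + r) + 1 ≤ ((d - 1 : ℝ) + r) ^ 2 := by nlinarith [hr2]
  refine nawMemGrowth_le_of_card_le_geometric (K := 4 * (d : ℝ) ^ 2) (by positivity) (by linarith) fun n => ?_
  have hgeo := card_nawFourWords_le_geometric hd hlam2 hroot n
  have hle : (nawMemCount d 4 (n + 2) : ℝ) ≤ ((nawFourWords d (n + 2)).card : ℝ) := by
    exact_mod_cast Finset.card_le_card (nawMemWords_four_subset d (n + 2))
  exact hle.trans hgeo

/-- **`μ^N_4(d) < 2d − 1`** for `d ≥ 2` (`√((d−1)²+1) < d`). [folklore] -/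
theorem nawMemGrowth_four_lt (hd : 2 ≤ d) : nawMemGrowth d 4 < 2 * (d : ℝ) - 1 := by
  have hd' : (2 : ℝ) ≤ d := by exact_mod_cast hd
  have hsq : Real.sqrt (((d : ℝ) - 1) ^ 2 + 1) < d := by
    rw [Real.sqrt_lt' (by linarith)]
    nlinarith
  have := nawMemGrowth_four_le_nawFourConst hd
  linarith

/-- **`μ^N_4(d) < μ^N_2(d)`**: the site hierarchy is STRICTLY monotone at its first rung, every `d ≥ 2`. [folklore] -/
theorem nawMemGrowth_four_lt_two (hd : 2 ≤ d) : nawMemGrowth d 4 < nawMemGrowth d 2 := by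
  haveI : NeZero d := ⟨by omega⟩
  rw [nawMemGrowth_two_eq]
  exact nawMemGrowth_four_lt hd

/-! ### The first rung of C4-site (a), lower half -/

/-- **`Δ^N_4(d) = ln(μ^N_2/μ^N_4) > 0`** for every `d ≥ 2`. [folklore] -/
theorem siteLoopCost_four_pos (hd : 2 ≤ d) : 0 < siteLoopCost d 4 := by
  haveI : NeZero d := ⟨by omega⟩
  unfold siteLoopCost
  rw [show (4 : ℕ) - 2 = 2 from rfl]
  exact Real.log_pos ((one_lt_div (nawMemGrowth_pos 4)).2 (nawMemGrowth_four_lt_two hd))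

/-- **`R^N_4(d) > 0` for every `d ≥ 2`**: the first rung of the lower inequality of the typed site law
(`siteLoopCompatWindow` of …PcintLoopExclusionSiteLaw) is a THEOREM.  (Measured `R^N_4 = 0.720 / 0.797 / 0.869` for `d = 3, 4, 6`.)
[folklore] -/
theorem siteLoopCompat_four_pos (hd : 2 ≤ d) : 0 < siteLoopCompat d 4 := by
  haveI : NeZero d := ⟨by omega⟩
  exact div_pos (siteLoopCost_four_pos hd) (siteLoopDensity_four_pos hd)

end Summit.CriticalPhenomena.PercolationContinuityZ3.Theorems.Pcint.NawTail
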